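/-
Copyright (c) 2026. All rights reserved.
Released under Apache 2.0 license as described in the file LICENSE.
-/
import Literature.Probability.FitznerVanDerHofstad2017.NobleBoundsNDispatchAll
import Literature.Probability.FitznerVanDerHofstad2017.NobleBoundsNLowE
import HarnessLib

/-!
# The `N = M + 2` size-model inequality (5.34) modulo the residual junction slots

Fitzner–van der Hofstad, *Nearest-neighbor percolation function is continuous for `d > 10`* (v1) /
*Mean-field behavior for nearest-neighbor percolation in `d > 10`* (arXiv:1506.07977v2), §5.1 (5.4), Prop. 5.5
(5.34), §6.1 (6.4) and App. B.

`NobleBoundsNDispatchAll` reduces the class estimate (6.4) at every class pair over `Fin 3 ⊕ Unit`, and with it the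
size-model inequality (5.34) at `N = M + 2` (`tsum_nobleXiT_le_secStar'_of_pairPackages`), to three PER-PAIR PACKAGE
families: the first regular pair (`hFR`), the middle regular pairs (`hMR`) and the middle lower-`★` pairs (`hML`).
Each of these families has its own case dispatcher with narrow hypothesis slots:
`NobleBoundsNDispatchReg.nonempty_jPkg_first_reg / nonempty_jPkg_mid_reg` (slots `hR'`, `hR`, `hK2`) and
`NobleBoundsNLowE.nonempty_jPkg_mid_starL'` (slots `hR'`, `hRS`).  This file composes them:

* §A `nonempty_jPkg_all_of_residuals` — `pkg` at every junction of the chain from EIGHT RESIDUAL SLOT families only: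
  at the first and at every middle regular pair the cases R′ (`σ = false`, `a' ≠ 0`, `w_{k+1} = t_k`),
  R (`τ_k = (true, 0)`, `a' = 2`, `t_k ≠ u_{k+1}`, `z_k = t_k`, `w_{k+1} ∼ t_k`) and K2 (`τ_k = (true, 2)`,
  `a_k = 1`, `a' = 2`, `t_k ≠ u_{k+1}`); at every middle lower-`★` pair the cases R′ and R over the closed level
  (`z_k = t_k = w_k`);
* §B `tsum_nobleXiT_le_secStar'_of_residuals` — (5.34) at `N = M + 2` over `Fin 3 ⊕ Unit` (section choice of
  `NobleBoundsNCoverPrime`) for every four-line remainder family `X` summing to a translation-invariant `X₂`, from the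
  same eight families quantified over all `(x, a, c, b⃗, w⃗, t⃗, z⃗, κ, τ)` with `τ` admissible.

Nothing is cited as fact: both results are compositions of landed theorems; the eight hypotheses are the cases of
the junction analysis of §6.1 / App. B not discharged in this directory (the coincidence configurations
`w_{k+1} = t_k`, `z_k = t_k ∼ w_{k+1}` and the entry-class-`1` / inner-class-`2` pairs with `t_k ≠ u_{k+1}`).
-/

noncomputable section

open scoped ENNReal

namespace Literature.Probability.FitznerVanDerHofstad2017

open Literature.Barriers.CriticalPhenomena Literature.Probability.Percolation
open Literature.Probability.LatticeModels Literature.Combinatorics.SimpleGraph _root_.SimpleGraph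
open _root_.MeasureTheory
open Literature.Probability.FitznerVanDerHofstad2017.NobleBlocks
open Literature.Probability.FitznerVanDerHofstad2017.NobleBlocks.LenIdx
open Literature.Probability.FitznerVanDerHofstad2017.BlockSummation

variable {d : ℕ}

/-! ### A. `pkg` at every junction from the residual slots -/

section Packages

variable (p : unitInterval) (M : ℕ) (x : Site d) (b : Fin (M + 2) → Site d × Site d) (w t z : Fin (M + 2) → Site d)
  (a : Fin (M + 2) → Fin 3 ⊕ Unit) (c : Fin 3 ⊕ Unit) (τ : Fin (M + 1) → Bool × Fin 3)

/-- **`pkg` AT EVERY JUNCTION FROM THE RESIDUAL SLOTS**: `NobleBoundsNDispatchAll.nonempty_jPkg_all` with its three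
per-pair package families supplied by the dispatchers `nonempty_jPkg_first_reg`, `nonempty_jPkg_mid_reg`
(`NobleBoundsNDispatchReg`) and `nonempty_jPkg_mid_starL'` (`NobleBoundsNLowE`).  What remains are the eight
residual case slots: R′ / R / K2 at the first pair (`hR'₀`, `hR₀`, `hK2₀`) and at the middle regular pairs
(`hR'`, `hR`, `hK2`), R′ / R over a closed lower level at the middle lower-`★` pairs (`hR'L`, `hRL`).
[cite: FitznerVanDerHofstad2017, §6.1 (6.4), "Case b = 0 / 1 / ≥ 2" and the coincidence cases `w' = t`, `z = t` (arXiv:1506.07977v2 pp. 58–59); App. B (pp. 75–76); §5.1 (5.4) (p. 48)] -/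
theorem nonempty_jPkg_all_of_residuals (κ : Fin (M + 2) → Fin d × Bool) (hκ : ∀ i, (b i).2 = (b i).1 + stepVec (κ i))
    (hτ : AdmT M a τ)
    (hR'₀ : ∀ a₀ a' : Fin 3, a (0 : Fin (M + 1)).castSucc = Sum.inl a₀ → a (0 : Fin (M + 1)).succ = Sum.inl a' →
      (τ 0).1 = false → a' ≠ 0 → w (0 : Fin (M + 1)).succ = t (0 : Fin (M + 1)).castSucc →
      Nonempty (JPkg p (jctx M x b w t z a τ (0 : Fin (M + 1)).castSucc) (JFacts M x b w t z a c τ)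
        (blockPS (Letters.perc d p) a₀ (b (0 : Fin (M + 1)).castSucc).1 (w (0 : Fin (M + 1)).castSucc) *
          tgtReg (Letters.perc d p) (κ (0 : Fin (M + 1)).castSucc) a₀ a' (b (0 : Fin (M + 1)).castSucc).1
            (w (0 : Fin (M + 1)).castSucc) (t (0 : Fin (M + 1)).castSucc) (z (0 : Fin (M + 1)).castSucc)
            (w (0 : Fin (M + 1)).succ) (b (0 : Fin (M + 1)).succ).1 (τ 0))))
    (hR₀ : ∀ a₀ a' : Fin 3, a (0 : Fin (M + 1)).castSucc = Sum.inl a₀ → a (0 : Fin (M + 1)).succ = Sum.inl a' →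
      τ 0 = (true, 0) → a' = 2 → t (0 : Fin (M + 1)).castSucc ≠ (b (0 : Fin (M + 1)).succ).1 →
      z (0 : Fin (M + 1)).castSucc = t (0 : Fin (M + 1)).castSucc →
      (zdGraph d).Adj (w (0 : Fin (M + 1)).succ) (t (0 : Fin (M + 1)).castSucc) →
      Nonempty (JPkg p (jctx M x b w t z a τ (0 : Fin (M + 1)).castSucc) (JFacts M x b w t z a c τ)
        (blockPS (Letters.perc d p) a₀ (b (0 : Fin (M + 1)).castSucc).1 (w (0 : Fin (M + 1)).castSucc) *
          tgtReg (Letters.perc d p) (κ (0 : Fin (M + 1)).castSucc) a₀ a' (b (0 : Fin (M + 1)).castSucc).1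
            (w (0 : Fin (M + 1)).castSucc) (t (0 : Fin (M + 1)).castSucc) (z (0 : Fin (M + 1)).castSucc)
            (w (0 : Fin (M + 1)).succ) (b (0 : Fin (M + 1)).succ).1 (τ 0))))
    (hK2₀ : ∀ a₀ a' : Fin 3, a (0 : Fin (M + 1)).castSucc = Sum.inl a₀ → a (0 : Fin (M + 1)).succ = Sum.inl a' →
      τ 0 = (true, 2) → a₀ = 1 → a' = 2 → t (0 : Fin (M + 1)).castSucc ≠ (b (0 : Fin (M + 1)).succ).1 →
      Nonempty (JPkg p (jctx M x b w t z a τ (0 : Fin (M + 1)).castSucc) (JFacts M x b w t z a c τ)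
        (blockPS (Letters.perc d p) a₀ (b (0 : Fin (M + 1)).castSucc).1 (w (0 : Fin (M + 1)).castSucc) *
          tgtReg (Letters.perc d p) (κ (0 : Fin (M + 1)).castSucc) a₀ a' (b (0 : Fin (M + 1)).castSucc).1
            (w (0 : Fin (M + 1)).castSucc) (t (0 : Fin (M + 1)).castSucc) (z (0 : Fin (M + 1)).castSucc)
            (w (0 : Fin (M + 1)).succ) (b (0 : Fin (M + 1)).succ).1 (τ 0))))
    (hR' : ∀ i i₀ : Fin (M + 1), i₀.succ = i.castSucc → ∀ a₀ a' : Fin 3, a i.castSucc = Sum.inl a₀ →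
      a i.succ = Sum.inl a' → (τ i).1 = false → a' ≠ 0 → w i.succ = t i.castSucc →
      Nonempty (JPkg p (jctx M x b w t z a τ i.castSucc) (JFacts M x b w t z a c τ)
        (tgtReg (Letters.perc d p) (κ i.castSucc) a₀ a' (b i.castSucc).1 (w i.castSucc) (t i.castSucc) (z i.castSucc)
          (w i.succ) (b i.succ).1 (τ i))))
    (hR : ∀ i i₀ : Fin (M + 1), i₀.succ = i.castSucc → ∀ a₀ a' : Fin 3, a i.castSucc = Sum.inl a₀ →
      a i.succ = Sum.inl a' → τ i = (true, 0) → a' = 2 → t i.castSucc ≠ (b i.succ).1 →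
      z i.castSucc = t i.castSucc → (zdGraph d).Adj (w i.succ) (t i.castSucc) →
      Nonempty (JPkg p (jctx M x b w t z a τ i.castSucc) (JFacts M x b w t z a c τ)
        (tgtReg (Letters.perc d p) (κ i.castSucc) a₀ a' (b i.castSucc).1 (w i.castSucc) (t i.castSucc) (z i.castSucc)
          (w i.succ) (b i.succ).1 (τ i))))
    (hK2 : ∀ i i₀ : Fin (M + 1), i₀.succ = i.castSucc → ∀ a₀ a' : Fin 3, a i.castSucc = Sum.inl a₀ →
      a i.succ = Sum.inl a' → τ i = (true, 2) → a₀ = 1 → a' = 2 → t i.castSucc ≠ (b i.succ).1 →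
      Nonempty (JPkg p (jctx M x b w t z a τ i.castSucc) (JFacts M x b w t z a c τ)
        (tgtReg (Letters.perc d p) (κ i.castSucc) a₀ a' (b i.castSucc).1 (w i.castSucc) (t i.castSucc) (z i.castSucc)
          (w i.succ) (b i.succ).1 (τ i))))
    (hR'L : ∀ i i₀ : Fin (M + 1), i₀.succ = i.castSucc → ∀ (u₀ : Unit) (a' : Fin 3), a i.castSucc = Sum.inr u₀ →
      a i.succ = Sum.inl a' → (τ i).1 = false → a' ≠ 0 → w i.succ = t i.castSucc →
      Nonempty (JPkg p (jctx M x b w t z a τ i.castSucc) (JFacts M x b w t z a c τ)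
        (tgtStarL (Letters.perc d p) (κ i.castSucc) a' (b i.castSucc).1 (w i.castSucc) (t i.castSucc) (z i.castSucc)
          (w i.succ) (b i.succ).1 (τ i))))
    (hRL : ∀ i i₀ : Fin (M + 1), i₀.succ = i.castSucc → ∀ (u₀ : Unit) (a' : Fin 3), a i.castSucc = Sum.inr u₀ →
      a i.succ = Sum.inl a' → (τ i).1 = true → (τ i).2 = 0 → a' = 2 → t i.castSucc ≠ (b i.succ).1 →
      z i.castSucc = t i.castSucc → z i.castSucc = w i.castSucc → (zdGraph d).Adj (w i.succ) (t i.castSucc) →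
      Nonempty (JPkg p (jctx M x b w t z a τ i.castSucc) (JFacts M x b w t z a c τ)
        (tgtStarL (Letters.perc d p) (κ i.castSucc) a' (b i.castSucc).1 (w i.castSucc) (t i.castSucc) (z i.castSucc)
          (w i.succ) (b i.succ).1 (τ i)))) :
    ∀ k, Nonempty (JPkg p (jctx M x b w t z a τ k) (JFacts M x b w t z a c τ)
      (jTarget M (tgtAll (Letters.perc d p) M a b w t z κ) (tgtLast (Letters.perc d p) M x a c b w t z κ) τ k)) :=
  nonempty_jPkg_all p M x b w t z a c τ κ hκ hτ
    (fun a₀ a' ha ha' => nonempty_jPkg_first_reg p M x b w t z a c τ (κ _) (hκ _) a₀ a' ha ha'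
      (hR'₀ a₀ a' ha ha') (hR₀ a₀ a' ha ha') (hK2₀ a₀ a' ha ha'))
    (fun i i₀ hk a₀ a' ha ha' => nonempty_jPkg_mid_reg p M x b w t z a c τ i i₀ hk (κ _) (hκ _) a₀ a' ha ha'
      (hR' i i₀ hk a₀ a' ha ha') (hR i i₀ hk a₀ a' ha ha') (hK2 i i₀ hk a₀ a' ha ha'))
    fun i i₀ hk u₀ a' ha ha' => nonempty_jPkg_mid_starL' p M x b w t z a c τ i i₀ hk (κ _) (hκ _) ha a' ha'
      (hR'L i i₀ hk u₀ a' ha ha') (hRL i i₀ hk u₀ a' ha ha')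

end Packages

/-! ### B. (5.34) at `N = M + 2` from the residual slots -/

section SizeModel

open scoped Matrix

variable (p : unitInterval) (M : ℕ)

/-- **(5.34) AT `N = M + 2` MODULO THE RESIDUAL JUNCTION SLOTS** (section choice of `NobleBoundsNCoverPrime`):
for every four-line remainder family `X` summing to a translation-invariant `X₂`,
`Σ_x Ξ̂^{(M+2)}(x) ≤ (P^S)ᵗ · B_sec^{M+1} · Ā_sec · P^E` over `Fin 3 ⊕ Unit`, granted the eight residual case slots
of `nonempty_jPkg_all_of_residuals` at every `(x, a, c, b⃗, w⃗, t⃗, z⃗)`, every direction assignment `κ` of the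
pivotal bonds and every admissible junction-type assignment `τ`.  Composition of
`NobleBoundsNDispatchAll.tsum_nobleXiT_le_secStar'_of_pairPackages` with the three dispatchers.
[cite: FitznerVanDerHofstad2017, Prop. 5.5 (5.34) (arXiv:1506.07977v2 p. 53); §5.1 (5.4) (p. 48) and "Elements of the bounds" (p. 49); §6.1 (6.4) (pp. 58–59); Lemma 6.1, §6.2.1 (6.48)–(6.51) (pp. 65–67)] -/
theorem tsum_nobleXiT_le_secStar'_of_residuals (X : DirBlockFamilyPt d) (X₂ : DirBlockFamily d)
    (hXsum : ∀ κ a a' u w w' u', ∑' t, ∑' z, X κ a a' u w t z w' u' = X₂ κ a a' u w w' u')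
    (hX₂ti : ∀ ι a b, IsTransInv (X₂ ι a b)) (hXti : ∀ κ a a', IsTransInv₆ (X κ a a'))
    (hR'₀ : ∀ (x : Site d) (a : Fin (M + 2) → Fin 3 ⊕ Unit) (c : Fin 3 ⊕ Unit) (b : Fin (M + 2) → Site d × Site d)
      (w t z : Fin (M + 2) → Site d),
      ∀ κ : Fin (M + 2) → Fin d × Bool, (∀ i, (b i).2 = (b i).1 + stepVec (κ i)) →
      ∀ τ : Fin (M + 1) → Bool × Fin 3, AdmT M a τ →
      ∀ a₀ a' : Fin 3, a (0 : Fin (M + 1)).castSucc = Sum.inl a₀ → a (0 : Fin (M + 1)).succ = Sum.inl a' →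
      (τ 0).1 = false → a' ≠ 0 → w (0 : Fin (M + 1)).succ = t (0 : Fin (M + 1)).castSucc →
      Nonempty (JPkg p (jctx M x b w t z a τ (0 : Fin (M + 1)).castSucc) (JFacts M x b w t z a c τ)
        (blockPS (Letters.perc d p) a₀ (b (0 : Fin (M + 1)).castSucc).1 (w (0 : Fin (M + 1)).castSucc) *
          tgtReg (Letters.perc d p) (κ (0 : Fin (M + 1)).castSucc) a₀ a' (b (0 : Fin (M + 1)).castSucc).1
            (w (0 : Fin (M + 1)).castSucc) (t (0 : Fin (M + 1)).castSucc) (z (0 : Fin (M + 1)).castSucc)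
            (w (0 : Fin (M + 1)).succ) (b (0 : Fin (M + 1)).succ).1 (τ 0))))
    (hR₀ : ∀ (x : Site d) (a : Fin (M + 2) → Fin 3 ⊕ Unit) (c : Fin 3 ⊕ Unit) (b : Fin (M + 2) → Site d × Site d)
      (w t z : Fin (M + 2) → Site d),
      ∀ κ : Fin (M + 2) → Fin d × Bool, (∀ i, (b i).2 = (b i).1 + stepVec (κ i)) →
      ∀ τ : Fin (M + 1) → Bool × Fin 3, AdmT M a τ →
      ∀ a₀ a' : Fin 3, a (0 : Fin (M + 1)).castSucc = Sum.inl a₀ → a (0 : Fin (M + 1)).succ = Sum.inl a' →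
      τ 0 = (true, 0) → a' = 2 → t (0 : Fin (M + 1)).castSucc ≠ (b (0 : Fin (M + 1)).succ).1 →
      z (0 : Fin (M + 1)).castSucc = t (0 : Fin (M + 1)).castSucc →
      (zdGraph d).Adj (w (0 : Fin (M + 1)).succ) (t (0 : Fin (M + 1)).castSucc) →
      Nonempty (JPkg p (jctx M x b w t z a τ (0 : Fin (M + 1)).castSucc) (JFacts M x b w t z a c τ)
        (blockPS (Letters.perc d p) a₀ (b (0 : Fin (M + 1)).castSucc).1 (w (0 : Fin (M + 1)).castSucc) *
          tgtReg (Letters.perc d p) (κ (0 : Fin (M + 1)).castSucc) a₀ a' (b (0 : Fin (M + 1)).castSucc).1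
            (w (0 : Fin (M + 1)).castSucc) (t (0 : Fin (M + 1)).castSucc) (z (0 : Fin (M + 1)).castSucc)
            (w (0 : Fin (M + 1)).succ) (b (0 : Fin (M + 1)).succ).1 (τ 0))))
    (hK2₀ : ∀ (x : Site d) (a : Fin (M + 2) → Fin 3 ⊕ Unit) (c : Fin 3 ⊕ Unit) (b : Fin (M + 2) → Site d × Site d)
      (w t z : Fin (M + 2) → Site d),
      ∀ κ : Fin (M + 2) → Fin d × Bool, (∀ i, (b i).2 = (b i).1 + stepVec (κ i)) →
      ∀ τ : Fin (M + 1) → Bool × Fin 3, AdmT M a τ →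
      ∀ a₀ a' : Fin 3, a (0 : Fin (M + 1)).castSucc = Sum.inl a₀ → a (0 : Fin (M + 1)).succ = Sum.inl a' →
      τ 0 = (true, 2) → a₀ = 1 → a' = 2 → t (0 : Fin (M + 1)).castSucc ≠ (b (0 : Fin (M + 1)).succ).1 →
      Nonempty (JPkg p (jctx M x b w t z a τ (0 : Fin (M + 1)).castSucc) (JFacts M x b w t z a c τ)
        (blockPS (Letters.perc d p) a₀ (b (0 : Fin (M + 1)).castSucc).1 (w (0 : Fin (M + 1)).castSucc) *
          tgtReg (Letters.perc d p) (κ (0 : Fin (M + 1)).castSucc) a₀ a' (b (0 : Fin (M + 1)).castSucc).1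
            (w (0 : Fin (M + 1)).castSucc) (t (0 : Fin (M + 1)).castSucc) (z (0 : Fin (M + 1)).castSucc)
            (w (0 : Fin (M + 1)).succ) (b (0 : Fin (M + 1)).succ).1 (τ 0))))
    (hR' : ∀ (x : Site d) (a : Fin (M + 2) → Fin 3 ⊕ Unit) (c : Fin 3 ⊕ Unit) (b : Fin (M + 2) → Site d × Site d)
      (w t z : Fin (M + 2) → Site d),
      ∀ κ : Fin (M + 2) → Fin d × Bool, (∀ i, (b i).2 = (b i).1 + stepVec (κ i)) →
      ∀ τ : Fin (M + 1) → Bool × Fin 3, AdmT M a τ →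
      ∀ i i₀ : Fin (M + 1), i₀.succ = i.castSucc → ∀ a₀ a' : Fin 3, a i.castSucc = Sum.inl a₀ →
      a i.succ = Sum.inl a' → (τ i).1 = false → a' ≠ 0 → w i.succ = t i.castSucc →
      Nonempty (JPkg p (jctx M x b w t z a τ i.castSucc) (JFacts M x b w t z a c τ)
        (tgtReg (Letters.perc d p) (κ i.castSucc) a₀ a' (b i.castSucc).1 (w i.castSucc) (t i.castSucc) (z i.castSucc)
          (w i.succ) (b i.succ).1 (τ i))))
    (hR : ∀ (x : Site d) (a : Fin (M + 2) → Fin 3 ⊕ Unit) (c : Fin 3 ⊕ Unit) (b : Fin (M + 2) → Site d × Site d)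
      (w t z : Fin (M + 2) → Site d),
      ∀ κ : Fin (M + 2) → Fin d × Bool, (∀ i, (b i).2 = (b i).1 + stepVec (κ i)) →
      ∀ τ : Fin (M + 1) → Bool × Fin 3, AdmT M a τ →
      ∀ i i₀ : Fin (M + 1), i₀.succ = i.castSucc → ∀ a₀ a' : Fin 3, a i.castSucc = Sum.inl a₀ →
      a i.succ = Sum.inl a' → τ i = (true, 0) → a' = 2 → t i.castSucc ≠ (b i.succ).1 →
      z i.castSucc = t i.castSucc → (zdGraph d).Adj (w i.succ) (t i.castSucc) →
      Nonempty (JPkg p (jctx M x b w t z a τ i.castSucc) (JFacts M x b w t z a c τ)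
        (tgtReg (Letters.perc d p) (κ i.castSucc) a₀ a' (b i.castSucc).1 (w i.castSucc) (t i.castSucc) (z i.castSucc)
          (w i.succ) (b i.succ).1 (τ i))))
    (hK2 : ∀ (x : Site d) (a : Fin (M + 2) → Fin 3 ⊕ Unit) (c : Fin 3 ⊕ Unit) (b : Fin (M + 2) → Site d × Site d)
      (w t z : Fin (M + 2) → Site d),
      ∀ κ : Fin (M + 2) → Fin d × Bool, (∀ i, (b i).2 = (b i).1 + stepVec (κ i)) →
      ∀ τ : Fin (M + 1) → Bool × Fin 3, AdmT M a τ →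
      ∀ i i₀ : Fin (M + 1), i₀.succ = i.castSucc → ∀ a₀ a' : Fin 3, a i.castSucc = Sum.inl a₀ →
      a i.succ = Sum.inl a' → τ i = (true, 2) → a₀ = 1 → a' = 2 → t i.castSucc ≠ (b i.succ).1 →
      Nonempty (JPkg p (jctx M x b w t z a τ i.castSucc) (JFacts M x b w t z a c τ)
        (tgtReg (Letters.perc d p) (κ i.castSucc) a₀ a' (b i.castSucc).1 (w i.castSucc) (t i.castSucc) (z i.castSucc)
          (w i.succ) (b i.succ).1 (τ i))))
    (hR'L : ∀ (x : Site d) (a : Fin (M + 2) → Fin 3 ⊕ Unit) (c : Fin 3 ⊕ Unit) (b : Fin (M + 2) → Site d × Site d)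
      (w t z : Fin (M + 2) → Site d),
      ∀ κ : Fin (M + 2) → Fin d × Bool, (∀ i, (b i).2 = (b i).1 + stepVec (κ i)) →
      ∀ τ : Fin (M + 1) → Bool × Fin 3, AdmT M a τ →
      ∀ i i₀ : Fin (M + 1), i₀.succ = i.castSucc → ∀ (u₀ : Unit) (a' : Fin 3), a i.castSucc = Sum.inr u₀ →
      a i.succ = Sum.inl a' → (τ i).1 = false → a' ≠ 0 → w i.succ = t i.castSucc →
      Nonempty (JPkg p (jctx M x b w t z a τ i.castSucc) (JFacts M x b w t z a c τ)
        (tgtStarL (Letters.perc d p) (κ i.castSucc) a' (b i.castSucc).1 (w i.castSucc) (t i.castSucc) (z i.castSucc)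
          (w i.succ) (b i.succ).1 (τ i))))
    (hRL : ∀ (x : Site d) (a : Fin (M + 2) → Fin 3 ⊕ Unit) (c : Fin 3 ⊕ Unit) (b : Fin (M + 2) → Site d × Site d)
      (w t z : Fin (M + 2) → Site d),
      ∀ κ : Fin (M + 2) → Fin d × Bool, (∀ i, (b i).2 = (b i).1 + stepVec (κ i)) →
      ∀ τ : Fin (M + 1) → Bool × Fin 3, AdmT M a τ →
      ∀ i i₀ : Fin (M + 1), i₀.succ = i.castSucc → ∀ (u₀ : Unit) (a' : Fin 3), a i.castSucc = Sum.inr u₀ →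
      a i.succ = Sum.inl a' → (τ i).1 = true → (τ i).2 = 0 → a' = 2 → t i.castSucc ≠ (b i.succ).1 →
      z i.castSucc = t i.castSucc → z i.castSucc = w i.castSucc → (zdGraph d).Adj (w i.succ) (t i.castSucc) →
      Nonempty (JPkg p (jctx M x b w t z a τ i.castSucc) (JFacts M x b w t z a c τ)
        (tgtStarL (Letters.perc d p) (κ i.castSucc) a' (b i.castSucc).1 (w i.castSucc) (t i.castSucc) (z i.castSucc)
          (w i.succ) (b i.succ).1 (τ i)))) :
    ∑' x, nobleXiT d p (M + 2) x ≤
      vecP (starS (blockPS (Letters.perc d p))) ᵥ*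
        matB (starB (blockBFull' (Letters.perc d p) X₂) (secEc (blockBFullpt' (Letters.perc d p) X) 0)
          (secEo (blockBFullpt' (Letters.perc d p) X) 2) (secEoc (blockBFullpt' (Letters.perc d p) X) 2 0)) ^ (M + 1) ᵥ*
          matAbar (starA (blockAbar' (Letters.perc d p)) (secEA (blockAbar' (Letters.perc d p)) 2)) ⬝ᵥ
        vecP (starS (blockPE (Letters.perc d p))) :=
  tsum_nobleXiT_le_secStar'_of_pairPackages p M X X₂ hXsum hX₂ti hXti
    (fun x a c b w t z κ hκ τ hτ a₀ a' ha ha' => nonempty_jPkg_first_reg p M x b w t z a c τ (κ _) (hκ _) a₀ a' ha ha'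
      (hR'₀ x a c b w t z κ hκ τ hτ a₀ a' ha ha') (hR₀ x a c b w t z κ hκ τ hτ a₀ a' ha ha')
      (hK2₀ x a c b w t z κ hκ τ hτ a₀ a' ha ha'))
    (fun x a c b w t z κ hκ τ hτ i i₀ hk a₀ a' ha ha' => nonempty_jPkg_mid_reg p M x b w t z a c τ i i₀ hk (κ _) (hκ _)
      a₀ a' ha ha' (hR' x a c b w t z κ hκ τ hτ i i₀ hk a₀ a' ha ha') (hR x a c b w t z κ hκ τ hτ i i₀ hk a₀ a' ha ha')
      (hK2 x a c b w t z κ hκ τ hτ i i₀ hk a₀ a' ha ha'))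
    fun x a c b w t z κ hκ τ hτ i i₀ hk u₀ a' ha ha' => nonempty_jPkg_mid_starL' p M x b w t z a c τ i i₀ hk (κ _) (hκ _)
      ha a' ha' (hR'L x a c b w t z κ hκ τ hτ i i₀ hk u₀ a' ha ha') (hRL x a c b w t z κ hκ τ hτ i i₀ hk u₀ a' ha ha')

end SizeModel

end Literature.Probability.FitznerVanDerHofstad2017

end
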